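import Summits.BirchSwinnertonDyer.BirchSwinnertonDyer.Theses.GenusKolyvaginAtTwo
import Summits.BirchSwinnertonDyer.BirchSwinnertonDyer.Theorems.GenusKolyvaginAtTwoMinimalTwinBSDTwoOddCutOfTranspositionWitness
import Summits.BirchSwinnertonDyer.BirchSwinnertonDyer.Theorems.GenusKolyvaginAtTwoMinimalTwinBSDTwoOddCutDepthZeroFrame
import Summits.BirchSwinnertonDyer.BirchSwinnertonDyer.Theorems.GenusKolyvaginAtTwoMinimalTwinBSDTwoTwinDoorClosedClass
import Summits.BirchSwinnertonDyer.BirchSwinnertonDyer.Theorems.GenusKolyvaginAtTwoMinimalTwinBSDTwoAnalyticTwin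
import Summits.BirchSwinnertonDyer.BirchSwinnertonDyer.Theorems.GenusKolyvaginAtTwoMinimalTwinBSDTwoOddManinDatum
import HarnessLib

/-!
# LINE 23 «twin_swap» v2.11 PROPOSAL «ANALYTIC BUDGET FRAME WITH DOOR BIT ⊕ DOOR-CLOSED DEEP WITNESS» (SEVEN stubs: WALL row 1 · PRINT×8 · Q2 · NVDOOR ·
# WITNESS_{dc,≥2} · DIV′|offcut · NDIV′|offcut) on crux hTw `MinimalTwinBSDTwo` (stmt-BirchSwinnertonDyer-22985, route `GenusKolyvaginAtTwo` rev 72) — the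
# v2.10 offer with the frame leaf stated WITHOUT Heegner data: ANALYTIC non-vanishing inside the genus budget + the Selmer door bit, the `2`-primitivity of
# `P(1)` asked only at a door-OPEN frame (seat `bsd-line-gk2-p2` g33); NOT registered (v2.5 `Lines/twin_swap.lean` 0c6111283b4b of record).
# Nothing here proves BSD, U₂, the wall, Q2, NVDOOR, WITNESS, DIV′ or NDIV′.

WHAT CHANGED vs v2.10 (`twin_swap_v210_proposal_g33_gk2p2.lean`, 3155ce6e97c1).  v2.10's leaf FRAME♮♮ still asked, for every odd datum `Dt`, for a
conductor-`1` Heegner datum `d₁` ON `Dt` with `P(1)` OF INFINITE ORDER.  Both are PRINT: `d₁` exists on EVERY datum at every Heegner `K`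
(`exists_kolyvaginHeegnerData_one` + `phi_heegnerTau_mem_singularModuliField_holds` + `exists_dvd_sq_sub_discr_of_ncard_primesOver`, tree theorems), and
`P(1)` is non-torsion as soon as `L(W^{(d_K)},1) ≠ 0` at analytic rank `1` (Gross–Zagier: `not_isOfFinAddOrder_derivedPoint_one_of_rankOne_of_lValue_ne_zero`,
mod GZ + modularity).  Hence the frame leaf is now
* NVDOOR `OddCutBudgetFrameDoorSupplyAtTwo` — per `W` on the cut: (i) if `4 ∣ N_W`, SOME odd-`c` datum (Manin at `v₂(N) ≥ 2`, open in print); (ii) ONE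
  imaginary quadratic `K` (`d_K` odd `≠ −3`, Heegner for `N_W`) with **`L(W^{(d_K)}, 1) ≠ 0`**, a globally minimal twin model `Wd` INSIDE THE GENUS BUDGET
  `(Δ_W < 0 ∧ v₂ C(Wd) ≤ 1) ∨ v₂ C(Wd) = 0`, and the DOOR BIT: EITHER `#Sel₂(Wd) ≠ 1` (door closed — nothing more asked) OR (door open) `P(1) ∉ 2W(K[1])`
  for EVERY odd-`c` datum and conductor-`1` datum on it (the classical `2`-primitivity = Kolyvagin–Zhang at `2` in the `Ш(W_K)[2] = 0` case; BSD-necessary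
  there, p816017).  Clause (ii) mixes NO Heegner object into the analytic part: «non-vanishing of ONE quadratic twist inside a Chebotarev-type budget class».
The closed glue `oddCutFrameSupplyDoor_of_budgetFrameDoor : AU → Čes → modularity → GZ → NVDOOR → FRAME♮` rebuilds v2.9's FRAME♮; the rest of v2.10
(`transpositionWitnessSupply_of_frame_of_witness`, p811686's on-cut road, v2.5's off-cut road) is UNCHANGED.
So **hTw ⟸ WALL row 1 + PRINT×8 + Q2 (24880) + NVDOOR + WITNESS_{dc,≥2} + DIV′|offcut + NDIV′|offcut** — seven stubs (= stubs_max).  BSD is NOT proved.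
-/

set_option linter.dupNamespace false -- `Summit.<P>.<Sub>` repeats `BirchSwinnertonDyer` (D-0017)

namespace Summit.BirchSwinnertonDyer.BirchSwinnertonDyer.Cruxes.MinimalTwinBSDTwo.TwinSwapV211

open scoped Classical NumberField

open Summit.BirchSwinnertonDyer.BirchSwinnertonDyer.Theses.GenusKolyvaginAtTwo
open WeierstrassCurve NumberField Literature.NumberTheory.EllipticCurves Literature.NumberTheory.EllipticCurves.ModularForms
open Summit.BirchSwinnertonDyer.BirchSwinnertonDyer.Theorems
open Summit.BirchSwinnertonDyer.BirchSwinnertonDyer.Theorems.GenusExact.TwinSwap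
open Summit.BirchSwinnertonDyer.BirchSwinnertonDyer.Theorems.GenusExact.TwinSwap.AnalyticTwin
  (swappedPairDescentAtTwo_shaDepth_anyTwin_of_facts)
open Summit.BirchSwinnertonDyer.BirchSwinnertonDyer.Theorems.GenusExact.TwinSwap.TwinAnnihilation
  (minimalTwinBSDTwo_onOddCut_of_wall_of_transpositionWitnessSupply_of_facts transpositionWitness_of_depth_zero
    exists_selmer_twist_four_ne_zero_of_natCard_selmerGroup_two_ne_one exists_transpositionWitness_of_depth_one_of_selmer_twist_ne_zero)
open Summit.BirchSwinnertonDyer.BirchSwinnertonDyer.Theorems.GenusExact.TwinSwapBit (rootNumber_eq_neg_one_of_analyticRank_eq_one)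
open Summit.BirchSwinnertonDyer.BirchSwinnertonDyer.Theorems.GenusExact.TwinSwap.Ledger.Line25
  (exists_kolyvaginHeegnerData_one_of_nonempty_modularParametrizationData not_isOfFinAddOrder_derivedPoint_one_of_rankOne_of_lValue_ne_zero)
open Summit.BirchSwinnertonDyer.BirchSwinnertonDyer.Theorems.KolyvaginAtTwo (exists_exactTwoDepth)
open Literature.NumberTheory.QuadraticFields.Quadratic (ncard_primesOver_two_eq_two_iff)

/-! ## The displayed Props -/

/-- S1′ · the ANCHOR (as in v2.5): BSD₂ for every non-CM globally minimal curve of analytic rank `0` (= WALL row 1 of route ByReductionTypeAtTwo). -/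
def RankZeroBSDTwo : Prop :=
  ∀ (W : WeierstrassCurve ℚ) [W.IsElliptic] [W.IsGloballyMinimal], ¬ W.HasCM → W.analyticRank = 0 →
    Literature.NumberTheory.EllipticCurves.BSDp W 2

/-- **The odd habitat cut** of a globally minimal `W/ℚ` (NO sign of `Δ`): odd Tamagawa product, `ρ_{W,2^n}` onto for all `n ≥ 1`, and an odd prime
of multiplicative reduction (the non-phantom input of the Kolyvagin engines at `2`). -/
def OnOddHabitatCut (W : WeierstrassCurve ℚ) [W.IsElliptic] : Prop :=
  Odd W.tamagawaProduct ∧ (∀ n : ℕ, 0 < n → W.HasSurjectiveModNGaloisRep ((2 : ℤ) ^ n)) ∧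
    ∃ v : IsDedekindDomain.HeightOneSpectrum (𝓞 ℚ), ((2 : ℕ) : 𝓞 ℚ) ∉ v.asIdeal ∧ ((W.conductorNorm ℤ : ℕ) : 𝓞 ℚ) ∈ v.asIdeal ∧
      W.HasMultiplicativeReductionAt v

/-- **SUPPLY^± — the transposition-witness supply for the rank-ONE member on the cut**, DERIVED below from Q2 + FRAME♮ + WITNESS_{dc,≥2} (VERBATIM the `hSupply` binder of
`TwinAnnihilation.minimalTwinBSDTwo_onOddCut_of_wall_of_transpositionWitnessSupply_of_facts`, g32): for every `W` on the odd habitat cut with `¬CM`,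
`r_an = 1`, `#Sel₂ = 2` (either sign of `Δ`): ONE imaginary quadratic `K` (`d_K` odd `≠ −3`, Heegner for `N_W`), a datum `Dt` with `Dt.c` odd, a
conductor-`1` datum `d₁` with `P(1)` of infinite order and its exact `2`-depth `M₀`, a globally minimal model `Wd ≅ W^{(d_K)}` inside the genus budget
`(Δ_W < 0 ∧ ord₂ C(Wd) ≤ 1) ∨ ord₂ C(Wd) = 0`, and a square-free `n` of TRANSPOSITION-deep Kolyvagin primes (Zhang-admissible at `2`, index `≥ 2`, an
arithmetic Frobenius at `ℓ` moves a point of `W[2]`) with `P(n) ∉ 2W(K[n])`.  The `ε = −1` mirror of the route's K₄ supplies; OPEN (research). -/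
def TranspositionWitnessSupplyAtTwo : Prop :=
  ∀ (W : WeierstrassCurve ℚ) [W.IsElliptic] [W.IsGloballyMinimal] [NeZero (W.conductorNorm ℤ)],
    ¬ W.HasCM → W.analyticRank = 1 → Nat.card (W.selmerGroup 2) = 2 → Odd W.tamagawaProduct →
    (∀ n : ℕ, 0 < n → W.HasSurjectiveModNGaloisRep ((2 : ℤ) ^ n)) →
    (∃ v : IsDedekindDomain.HeightOneSpectrum (𝓞 ℚ), ((2 : ℕ) : 𝓞 ℚ) ∉ v.asIdeal ∧ ((W.conductorNorm ℤ : ℕ) : 𝓞 ℚ) ∈ v.asIdeal ∧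
      W.HasMultiplicativeReductionAt v) →
    ∃ (K : Type) (_ : Field K) (_ : NumberField K), IsImaginaryQuadratic K ∧ Odd (NumberField.discr K) ∧ NumberField.discr K ≠ -3 ∧
      SatisfiesHeegnerHypothesis (W.conductorNorm ℤ) K ∧
      ∃ (Dt : ModularParametrizationData W (W.conductorNorm ℤ)) (β : ℤ) (ι : K →+* ℂ) (d₁ : KolyvaginHeegnerData Dt β ι 1) (M₀ : ℕ),
        Odd Dt.c ∧ ¬ IsOfFinAddOrder d₁.derivedPoint ∧
        (∃ Q : (W.baseChange (ringClassField K ι 1)).toAffine.Point, ((2 ^ M₀ : ℕ) : ℤ) • Q = d₁.derivedPoint) ∧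
        (¬ ∃ Q : (W.baseChange (ringClassField K ι 1)).toAffine.Point, ((2 ^ (M₀ + 1) : ℕ) : ℤ) • Q = d₁.derivedPoint) ∧
        (∃ (Wd : WeierstrassCurve ℚ) (_ : Wd.IsElliptic) (_ : Wd.IsGloballyMinimal),
          (∃ C : VariableChange ℚ, C • W.quadraticTwist (NumberField.discr K : ℚ) = Wd) ∧
            ((W.Δ < 0 ∧ padicValNat 2 Wd.tamagawaProduct ≤ 1) ∨ padicValNat 2 Wd.tamagawaProduct = 0)) ∧
        ∃ (n : ℕ) (d : KolyvaginHeegnerData Dt β ι n), Squarefree n ∧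
          (∀ ℓ ∈ n.primeFactors, Zhang2014.IsKolyvaginPrime (W.conductorNorm ℤ) W K 2 ℓ ∧ 2 ≤ Zhang2014.kolyvaginIndex W 2 ℓ ∧
            ∃ (v : IsDedekindDomain.HeightOneSpectrum (𝓞 ℚ))
              (𝔓 : Ideal (Literature.NumberTheory.GaloisRepresentations.absIntegers (𝓞 ℚ) ℚ)) (h : Field.absoluteGaloisGroup ℚ),
              ((ℓ : ℕ) : 𝓞 ℚ) ∈ v.asIdeal ∧ 𝔓 ∈ v.primesAbove ∧ IsArithFrobAt (𝓞 ℚ) h 𝔓 ∧ ∃ u : W.geomTorsion ((2 : ℕ) : ℤ), h • u ≠ u) ∧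
          ¬ ∃ Q : (W.baseChange (ringClassField K ι n)).toAffine.Point, (2 : ℤ) • Q = d.derivedPoint

/-- **FRAME♮ — the door-aware frame supply on the odd habitat cut** (v2.9's leaf; in v2.11 a DERIVED display: `oddCutFrameSupplyDoor_of_budgetFrameDoor`): for every `W` on the cut with `¬CM`, `r_an = 1`,
`#Sel₂ = 2`: ONE imaginary quadratic `K` (`d_K` odd `≠ −3`, Heegner for `N_W`), a datum `Dt` with `Dt.c` odd, a conductor-`1` datum `d₁` with `P(1)` of
infinite order, a globally minimal model `Wd ≅ W^{(d_K)}` inside the genus budget `(Δ_W < 0 ∧ ord₂ C(Wd) ≤ 1) ∨ ord₂ C(Wd) = 0`, and EITHER `P(1) ∉ 2W(K[1])`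
(the frame has depth `0` — forced at door-open frames, `…DoorOpenNoDeepWitness`) OR `#Sel₂(Wd) ≠ 1` (door CLOSED). -/
def OddCutFrameSupplyDoorAtTwo : Prop :=
  ∀ (W : WeierstrassCurve ℚ) [W.IsElliptic] [W.IsGloballyMinimal] [NeZero (W.conductorNorm ℤ)],
    ¬ W.HasCM → W.analyticRank = 1 → Nat.card (W.selmerGroup 2) = 2 → Odd W.tamagawaProduct →
    (∀ n : ℕ, 0 < n → W.HasSurjectiveModNGaloisRep ((2 : ℤ) ^ n)) →
    (∃ v : IsDedekindDomain.HeightOneSpectrum (𝓞 ℚ), ((2 : ℕ) : 𝓞 ℚ) ∉ v.asIdeal ∧ ((W.conductorNorm ℤ : ℕ) : 𝓞 ℚ) ∈ v.asIdeal ∧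
      W.HasMultiplicativeReductionAt v) →
    ∃ (K : Type) (_ : Field K) (_ : NumberField K), IsImaginaryQuadratic K ∧ Odd (NumberField.discr K) ∧ NumberField.discr K ≠ -3 ∧
      SatisfiesHeegnerHypothesis (W.conductorNorm ℤ) K ∧
      ∃ (Dt : ModularParametrizationData W (W.conductorNorm ℤ)) (β : ℤ) (ι : K →+* ℂ) (d₁ : KolyvaginHeegnerData Dt β ι 1),
        Odd Dt.c ∧ ¬ IsOfFinAddOrder d₁.derivedPoint ∧
        ∃ (Wd : WeierstrassCurve ℚ) (_ : Wd.IsElliptic) (_ : Wd.IsGloballyMinimal),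
          (∃ C : VariableChange ℚ, C • W.quadraticTwist (NumberField.discr K : ℚ) = Wd) ∧
            ((W.Δ < 0 ∧ padicValNat 2 Wd.tamagawaProduct ≤ 1) ∨ padicValNat 2 Wd.tamagawaProduct = 0) ∧
            ((¬ ∃ Q : (W.baseChange (ringClassField K ι 1)).toAffine.Point, (2 : ℤ) • Q = d₁.derivedPoint) ∨ Nat.card (Wd.selmerGroup 2) ≠ 1)

/-- **NVDOOR — the analytic budget frame with its door bit** (the research frame leaf of v2.11; v2.9's FRAME♮ is DERIVED from it by
`oddCutFrameSupplyDoor_of_budgetFrameDoor` modulo Abbes–Ullmo + Česnavičius + modularity + Gross–Zagier): for every `W` on the odd habitat cut with `¬CM`,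
`r_an = 1`, `#Sel₂ = 2`: (i) if `4 ∣ N_W`, SOME datum `Dt` with `Odd Dt.c` (open in print only there); (ii) ONE imaginary quadratic `K` (`d_K` odd `≠ −3`,
Heegner for `N_W`) with `L(W^{(d_K)}, 1) ≠ 0`, a globally minimal model `Wd ≅ W^{(d_K)}` inside the genus budget, and EITHER `#Sel₂(Wd) ≠ 1` OR — at a
door-OPEN frame — `P(1) ∉ 2W(K[1])` for every odd-`c` datum `Dt` and every conductor-`1` Heegner datum on it.  OPEN (research: (ii) = quadratic-twist
non-vanishing inside a Chebotarev-type budget class — prime frames have automatic budget, p813652 — plus Kolyvagin–Zhang `2`-primitivity at door-open frames). -/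
def OddCutBudgetFrameDoorSupplyAtTwo : Prop :=
  ∀ (W : WeierstrassCurve ℚ) [W.IsElliptic] [W.IsGloballyMinimal] [NeZero (W.conductorNorm ℤ)],
    ¬ W.HasCM → W.analyticRank = 1 → Nat.card (W.selmerGroup 2) = 2 → Odd W.tamagawaProduct →
    (∀ n : ℕ, 0 < n → W.HasSurjectiveModNGaloisRep ((2 : ℤ) ^ n)) →
    (∃ v : IsDedekindDomain.HeightOneSpectrum (𝓞 ℚ), ((2 : ℕ) : 𝓞 ℚ) ∉ v.asIdeal ∧ ((W.conductorNorm ℤ : ℕ) : 𝓞 ℚ) ∈ v.asIdeal ∧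
      W.HasMultiplicativeReductionAt v) →
    (4 ∣ W.conductorNorm ℤ → ∃ Dt : ModularParametrizationData W (W.conductorNorm ℤ), Odd Dt.c) ∧
    ∃ (K : Type) (_ : Field K) (_ : NumberField K), IsImaginaryQuadratic K ∧ Odd (NumberField.discr K) ∧ NumberField.discr K ≠ -3 ∧
      SatisfiesHeegnerHypothesis (W.conductorNorm ℤ) K ∧ (W.quadraticTwist (NumberField.discr K : ℚ)).entireLFunction 1 ≠ 0 ∧
      ∃ (Wd : WeierstrassCurve ℚ) (_ : Wd.IsElliptic) (_ : Wd.IsGloballyMinimal),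
        (∃ C : VariableChange ℚ, C • W.quadraticTwist (NumberField.discr K : ℚ) = Wd) ∧
          ((W.Δ < 0 ∧ padicValNat 2 Wd.tamagawaProduct ≤ 1) ∨ padicValNat 2 Wd.tamagawaProduct = 0) ∧
          (Nat.card (Wd.selmerGroup 2) ≠ 1 ∨
            ∀ (Dt : ModularParametrizationData W (W.conductorNorm ℤ)), Odd Dt.c → ∀ (β : ℤ) (ι : K →+* ℂ) (d₁ : KolyvaginHeegnerData Dt β ι 1),
              ¬ ∃ Q : (W.baseChange (ringClassField K ι 1)).toAffine.Point, (2 : ℤ) • Q = d₁.derivedPoint)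

/-- **WITNESS_{dc,≥2} — the transposition-deep witness at DOOR-CLOSED frames of depth `≥ 2`** (the KOLYVAGIN leaf, in K₄'s quantifier shape): for
EVERY `W` on the odd habitat cut with `¬CM`, `r_an = 1`, `#Sel₂ = 2`, EVERY odd Heegner frame `K ≠ ℚ(√−3)`, EVERY odd-`c` datum and conductor-`1` datum
whose `P(1)` has infinite order and exact `2`-depth `M₀ ≥ 2`, and every globally minimal twin model inside the genus budget with `#Sel₂(Wd) ≠ 1`: a
square-free `n` of TRANSPOSITION-deep Kolyvagin primes (Zhang-admissible at `2`, index `≥ 2`, an arithmetic Frobenius at `ℓ` moves a point of `W[2]`)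
with `P(n) ∉ 2W(K[n])`.  Kolyvagin's conjecture at `2` (`M_∞ = 0` form) for the `ε = −1` member beyond the reach of one halving; the `ε = −1` mirror of
K₄ at depth `≥ 2`.  OPEN (research).  NOTE (REF1 R439a): the `∀`-frame shape is a CHOICE for K₄-uniformity — the composition needs the witness only
at the ONE frame FRAME♮ picks; a prover with frame-special witnesses should target SUPPLY^± (`TranspositionWitnessSupplyAtTwo`, consumed by p811686) or
the PRIME-FRAME supply (p813652) directly. -/
def OddCutDeepWitnessDoorClosedAtTwo : Prop :=
  ∀ (W : WeierstrassCurve ℚ) [W.IsElliptic] [W.IsGloballyMinimal] [NeZero (W.conductorNorm ℤ)],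
    ¬ W.HasCM → W.analyticRank = 1 → Nat.card (W.selmerGroup 2) = 2 → Odd W.tamagawaProduct →
    (∀ n : ℕ, 0 < n → W.HasSurjectiveModNGaloisRep ((2 : ℤ) ^ n)) →
    (∃ v : IsDedekindDomain.HeightOneSpectrum (𝓞 ℚ), ((2 : ℕ) : 𝓞 ℚ) ∉ v.asIdeal ∧ ((W.conductorNorm ℤ : ℕ) : 𝓞 ℚ) ∈ v.asIdeal ∧
      W.HasMultiplicativeReductionAt v) →
    ∀ (K : Type) [Field K] [NumberField K], IsImaginaryQuadratic K → Odd (NumberField.discr K) → NumberField.discr K ≠ -3 →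
      SatisfiesHeegnerHypothesis (W.conductorNorm ℤ) K →
    ∀ (Dt : ModularParametrizationData W (W.conductorNorm ℤ)), Odd Dt.c →
    ∀ (β : ℤ) (ι : K →+* ℂ) (d₁ : KolyvaginHeegnerData Dt β ι 1), ¬ IsOfFinAddOrder d₁.derivedPoint →
    ∀ (M₀ : ℕ), (∃ Q : (W.baseChange (ringClassField K ι 1)).toAffine.Point, ((2 ^ M₀ : ℕ) : ℤ) • Q = d₁.derivedPoint) →
      (¬ ∃ Q : (W.baseChange (ringClassField K ι 1)).toAffine.Point, ((2 ^ (M₀ + 1) : ℕ) : ℤ) • Q = d₁.derivedPoint) → 2 ≤ M₀ →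
    ∀ (Wd : WeierstrassCurve ℚ) [Wd.IsElliptic] [Wd.IsGloballyMinimal],
      (∃ C : VariableChange ℚ, C • W.quadraticTwist (NumberField.discr K : ℚ) = Wd) →
      ((W.Δ < 0 ∧ padicValNat 2 Wd.tamagawaProduct ≤ 1) ∨ padicValNat 2 Wd.tamagawaProduct = 0) → Nat.card (Wd.selmerGroup 2) ≠ 1 →
      ∃ (n : ℕ) (d : KolyvaginHeegnerData Dt β ι n), Squarefree n ∧
        (∀ ℓ ∈ n.primeFactors, Zhang2014.IsKolyvaginPrime (W.conductorNorm ℤ) W K 2 ℓ ∧ 2 ≤ Zhang2014.kolyvaginIndex W 2 ℓ ∧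
          ∃ (v : IsDedekindDomain.HeightOneSpectrum (𝓞 ℚ))
            (𝔓 : Ideal (Literature.NumberTheory.GaloisRepresentations.absIntegers (𝓞 ℚ) ℚ)) (h : Field.absoluteGaloisGroup ℚ),
            ((ℓ : ℕ) : 𝓞 ℚ) ∈ v.asIdeal ∧ 𝔓 ∈ v.primesAbove ∧ IsArithFrobAt (𝓞 ℚ) h 𝔓 ∧ ∃ u : W.geomTorsion ((2 : ℕ) : ℤ), h • u ≠ u) ∧
        ¬ ∃ Q : (W.baseChange (ringClassField K ι n)).toAffine.Point, (2 : ℤ) • Q = d.derivedPoint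

/-- DIV′|offcut · v2.5's `HeegnerIndexUpperAnyTwinAtTwo` VERBATIM with the single binder `¬ OnOddHabitatCut W` inserted after `#Sel₂(W) = 2` (on the
cut DIV′ is this seat's kernel theorem `heegnerIndexUpper_conclusion_onOddCut_signFree`, mod Q2 + GZK, inside the budget). -/
def HeegnerIndexUpperOffCutAtTwo : Prop :=
  ∀ (W : WeierstrassCurve ℚ) [W.IsElliptic] [W.IsGloballyMinimal] [NeZero (W.conductorNorm ℤ)],
    ¬ W.HasCM → W.analyticRank = 1 → Nat.card (W.selmerGroup 2) = 2 → ¬ OnOddHabitatCut W →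
    ∀ (K : Type) [Field K] [NumberField K], IsImaginaryQuadratic K →
      Odd (NumberField.discr K) → NumberField.discr K ≠ -3 → SatisfiesHeegnerHypothesis (W.conductorNorm ℤ) K →
      ((Ideal.span {(2 : ℤ)}).primesOver (𝓞 K)).ncard = 2 →
      ∀ (Wd : WeierstrassCurve ℚ) [Wd.IsElliptic] [Wd.IsGloballyMinimal],
        (∃ C : VariableChange ℚ, C • W.quadraticTwist (NumberField.discr K : ℚ) = Wd) →
      (W.quadraticTwist (NumberField.discr K : ℚ)).entireLFunction 1 ≠ 0 →
      ∀ (Dt : ModularParametrizationData W (W.conductorNorm ℤ)) (β : ℤ) (ι : K →+* ℂ) (d₁ : KolyvaginHeegnerData Dt β ι 1) (M₀ : ℕ),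
        (∃ Q : (W.baseChange (ringClassField K ι 1)).toAffine.Point, ((2 ^ M₀ : ℕ) : ℤ) • Q = d₁.derivedPoint) →
        (¬ ∃ Q : (W.baseChange (ringClassField K ι 1)).toAffine.Point, ((2 ^ (M₀ + 1) : ℕ) : ℤ) • Q = d₁.derivedPoint) →
          Nat.card (AddCommGroup.primaryComponent (W.baseChange K).sha 2) *
              2 ^ (2 * (padicValInt 2 Dt.c + padicValNat 2 W.tamagawaProduct)) ∣ 2 ^ (2 * M₀)

/-- NDIV′|offcut · v2.5's `HeegnerIndexLowerAnyTwinAtTwo` VERBATIM with the single binder `¬ OnOddHabitatCut W` inserted after `#Sel₂(W) = 2`. -/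
def HeegnerIndexLowerOffCutAtTwo : Prop :=
  ∀ (W : WeierstrassCurve ℚ) [W.IsElliptic] [W.IsGloballyMinimal] [NeZero (W.conductorNorm ℤ)],
    ¬ W.HasCM → W.analyticRank = 1 → Nat.card (W.selmerGroup 2) = 2 → ¬ OnOddHabitatCut W →
    ∀ (K : Type) [Field K] [NumberField K], IsImaginaryQuadratic K →
      Odd (NumberField.discr K) → NumberField.discr K ≠ -3 → SatisfiesHeegnerHypothesis (W.conductorNorm ℤ) K →
      ((Ideal.span {(2 : ℤ)}).primesOver (𝓞 K)).ncard = 2 →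
      ∀ (Wd : WeierstrassCurve ℚ) [Wd.IsElliptic] [Wd.IsGloballyMinimal],
        (∃ C : VariableChange ℚ, C • W.quadraticTwist (NumberField.discr K : ℚ) = Wd) →
      (W.quadraticTwist (NumberField.discr K : ℚ)).entireLFunction 1 ≠ 0 →
      ∀ (Dt : ModularParametrizationData W (W.conductorNorm ℤ)) (β : ℤ) (ι : K →+* ℂ) (d₁ : KolyvaginHeegnerData Dt β ι 1) (M₀ : ℕ),
        (∃ Q : (W.baseChange (ringClassField K ι 1)).toAffine.Point, ((2 ^ M₀ : ℕ) : ℤ) • Q = d₁.derivedPoint) →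
        (¬ ∃ Q : (W.baseChange (ringClassField K ι 1)).toAffine.Point, ((2 ^ (M₀ + 1) : ℕ) : ℤ) • Q = d₁.derivedPoint) →
          2 ^ (2 * M₀) ∣ Nat.card (AddCommGroup.primaryComponent (W.baseChange K).sha 2) *
              2 ^ (2 * (padicValInt 2 Dt.c + padicValNat 2 W.tamagawaProduct))

/-! ## The seven stubs -/

/-- stub WALL = items 19095–19098 of route ByReductionTypeAtTwo (WALL row 1) BY NAME — the anchor (as in v2.5). -/
theorem stub_wallRankZeroAtTwo :
    Summit.BirchSwinnertonDyer.BirchSwinnertonDyer.Theses.ByReductionTypeAtTwo.GoodOrdinaryRankZeroAtTwo ∧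
      Summit.BirchSwinnertonDyer.BirchSwinnertonDyer.Theses.ByReductionTypeAtTwo.MultiplicativeRankZeroAtTwo ∧
      Summit.BirchSwinnertonDyer.BirchSwinnertonDyer.Theses.ByReductionTypeAtTwo.SupersingularRankZeroAtTwo ∧
      Summit.BirchSwinnertonDyer.BirchSwinnertonDyer.Theses.ByReductionTypeAtTwo.AdditiveRankZeroAtTwo := by
  sorry

/-- stub PRINT = the route's four print items BY NAME + BCDT + Friedberg–Hoffstein (as in v2.5) + Abbes–Ullmo Thm. A + Česnavičius Thm. 1.2 (`2 ∥ N`)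
(named facts of `Literature/NumberTheory/EllipticCurves/ManinConstantSemistablePrimewise.lean`, statements only: Néron models of `J₀(N)`). -/
theorem stub_printFacts :
    GrossZagierAllLevels ∧ MultPublishedInputsAtTwo ∧ EntireLFunctionRat ∧ MilneAnyModel ∧ nonempty_modularParametrizationData ∧
      friedbergHoffstein_exists_heegnerField_split_twist_ne_zero ∧ abbesUllmo_not_dvd_maninConstant_of_not_dvd_level ∧
      cesnavicius_not_two_dvd_maninConstant_of_two_dvd_level := by
  sorry

/-- stub Q2 = item stmt-BirchSwinnertonDyer-24880 `KolyvaginRelationAtTwo` BY NAME (McCallum Prop. 4.4 at `2`; the antecedent of every Kolyvagin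
engine of the route). -/
theorem stub_kolyvaginRelationAtTwo : KolyvaginRelationAtTwo := by
  sorry

/-- stub NVDOOR — the analytic budget frame with its door bit on the odd habitat cut (research; the analytic-plus-Selmer leaf, no Heegner object in the
analytic part, Manin-free off `v₂(N_W) ≥ 2`). -/
theorem stub_oddCutBudgetFrameDoorSupply : OddCutBudgetFrameDoorSupplyAtTwo := by
  sorry

/-- stub WITNESS_{dc,≥2} — the transposition-deep witness at door-closed frames of depth ≥ 2 (research; the Kolyvagin leaf, `ε = −1` mirror of K₄). -/
theorem stub_oddCutDeepWitnessDoorClosed : OddCutDeepWitnessDoorClosedAtTwo := by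
  sorry

/-- stub DIV′|offcut — the upper half off the cut (research; v2.5's DIV′ restricted). -/
theorem stub_heegnerIndexUpperOffCut : HeegnerIndexUpperOffCutAtTwo := by
  sorry

/-- stub NDIV′|offcut — the lower half off the cut (research; v2.5's NDIV′ restricted). -/
theorem stub_heegnerIndexLowerOffCut : HeegnerIndexLowerOffCutAtTwo := by
  sorry

/-! ## Closed pieces -/

/-- **Abbes–Ullmo + Česnavičius + modularity + Gross–Zagier + NVDOOR ⟹ FRAME♮** (v2.9's leaf is DERIVED): per `W` on the cut, the odd datum is
manufactured by `OddManin.exists_datum_odd_c_conductor_of_forall_hasSurjectiveModNGaloisRep_of_not_four_dvd` (p816794) when `4 ∤ N_W` and taken from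
clause (i) of NVDOOR when `4 ∣ N_W`; at NVDOOR's frame `K` a conductor-`1` Heegner datum on it EXISTS (`exists_kolyvaginHeegnerData_one`, with
`phi_heegnerTau_mem_singularModuliField_holds` and `exists_dvd_sq_sub_discr_of_ncard_primesOver`), its `P(1)` is non-torsion by Gross–Zagier at analytic
rank `1` (`not_isOfFinAddOrder_derivedPoint_one_of_rankOne_of_lValue_ne_zero`), and the door bit is NVDOOR's.  No sorry of its own. -/
theorem oddCutFrameSupplyDoor_of_budgetFrameDoor (hAU : abbesUllmo_not_dvd_maninConstant_of_not_dvd_level)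
    (hCes : cesnavicius_not_two_dvd_maninConstant_of_two_dvd_level) (hMP : nonempty_modularParametrizationData) (hGZ : GrossZagierAllLevels)
    (hmod : EntireLFunctionRat) (hNV : OddCutBudgetFrameDoorSupplyAtTwo) : OddCutFrameSupplyDoorAtTwo := by
  intro W _ _ _ hcm hr hSel hT hρ hv
  obtain ⟨h4, K, iF, iN, hK, hodd, h3, hH, hLv, Wd, iE, iM, hWd, hbudget, hdoor⟩ := hNV W hcm hr hSel hT hρ hv
  have hDt : ∃ Dt : ModularParametrizationData W (W.conductorNorm ℤ), Odd Dt.c := by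
    by_cases hN : 4 ∣ W.conductorNorm ℤ
    · exact h4 hN
    · exact OddManin.exists_datum_odd_c_conductor_of_forall_hasSurjectiveModNGaloisRep_of_not_four_dvd hAU hCes hMP W hρ hN
  obtain ⟨Dt, hc⟩ := hDt
  -- a conductor-`1` Heegner datum on `Dt` at the frame `K`
  obtain ⟨β, hβ⟩ : ∃ β : ℤ, (4 * (W.conductorNorm ℤ : ℕ) : ℤ) ∣ β ^ 2 - NumberField.discr K :=
    Literature.NumberTheory.QuadraticFields.Quadratic.exists_dvd_sq_sub_discr_of_ncard_primesOver hK.1 (NeZero.ne _) hH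
  obtain ⟨ι⟩ : Nonempty (K →+* ℂ) := inferInstance
  obtain ⟨d₁⟩ := exists_kolyvaginHeegnerData_one (phi_heegnerTau_mem_singularModuliField_holds (W.conductorNorm ℤ) W K) hK Dt β ι hβ
  -- `P(1)` has infinite order (Gross–Zagier at analytic rank `1`, `L(W^{(d_K)},1) ≠ 0`)
  have hy : ¬ IsOfFinAddOrder d₁.derivedPoint :=
    not_isOfFinAddOrder_derivedPoint_one_of_rankOne_of_lValue_ne_zero hmod W K (hGZ _ W K) hK hH hr hLv d₁
  refine ⟨K, iF, iN, hK, hodd, h3, hH, Dt, β, ι, d₁, hc, hy, Wd, iE, iM, hWd, hbudget, ?_⟩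
  rcases hdoor with hdc | hprim
  · exact Or.inr hdc
  · exact Or.inl (hprim Dt hc β ι d₁)

/-- WALL row 1 ⟹ S1′ (as in v2.5). -/
theorem rankZeroBSDTwo_of_wall (hOrd : Summit.BirchSwinnertonDyer.BirchSwinnertonDyer.Theses.ByReductionTypeAtTwo.GoodOrdinaryRankZeroAtTwo)
    (hMult : Summit.BirchSwinnertonDyer.BirchSwinnertonDyer.Theses.ByReductionTypeAtTwo.MultiplicativeRankZeroAtTwo)
    (hSS : Summit.BirchSwinnertonDyer.BirchSwinnertonDyer.Theses.ByReductionTypeAtTwo.SupersingularRankZeroAtTwo)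
    (hAdd : Summit.BirchSwinnertonDyer.BirchSwinnertonDyer.Theses.ByReductionTypeAtTwo.AdditiveRankZeroAtTwo) : RankZeroBSDTwo := by
  intro W _ _ hCM hr
  by_cases hg : W.HasGoodReductionAtPrime 2
  · by_cases hd : ((2 : ℕ) : ℤ) ∣ W.frobeniusTrace 2
    · exact hSS W hCM hr ⟨hg, hd⟩
    · exact hOrd W hCM hr ⟨hg, hd⟩
  · by_cases hm : W.HasMultiplicativeReductionAtPrime 2
    · exact hMult W hCM hr hm
    · exact hAdd W hCM hr ⟨hg, hm⟩

/-- **Q2 + FRAME♮ + WITNESS_{dc,≥2} ⟹ SUPPLY^±**: pick the frame, read the exact `2`-depth `M₀` of `P(1)` (`exists_exactTwoDepth`); at `M₀ = 0` the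
witness is `(1, d₁)` (p812083); at `M₀ ≥ 1` the depth-zero disjunct of FRAME♮ is refuted by `hdiv`, so the door is CLOSED: at `M₀ = 1` the witness is
MANUFACTURED by B2Q♭⁻± (p813942/p814078, the nonzero twin class from `#Sel₂(Wd) ≠ 1` by `exists_selmer_twist_four_ne_zero_…`), at `M₀ ≥ 2` it is
WITNESS_{dc,≥2}'s.  No sorry of its own. -/
theorem transpositionWitnessSupply_of_frame_of_witness (hQ2 : KolyvaginRelationAtTwo) (hFrame : OddCutFrameSupplyDoorAtTwo)
    (hWit : OddCutDeepWitnessDoorClosedAtTwo) : TranspositionWitnessSupplyAtTwo := by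
  intro W _ _ _ hcm hr hSel hT hρ hv
  obtain ⟨K, iF, iN, hK, hodd, h3, hH, Dt, β, ι, d₁, hc, hy, Wd, iE, iM, hWd, hbudget, hdoor⟩ := hFrame W hcm hr hSel hT hρ hv
  haveI := (finiteDimensional_and_isGalois_ringClassField hK ι one_ne_zero).1
  haveI : NumberField (ringClassField K ι 1) := NumberField.of_module_finite K _
  haveI : (W.baseChange (ringClassField K ι 1)).IsElliptic := by rw [baseChange]; infer_instance
  haveI : Module.Finite ℤ (W.baseChange (ringClassField K ι 1)).toAffine.Point := by
    convert (W.baseChange (ringClassField K ι 1)).module_finite_point_holds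
  obtain ⟨M₀, hdiv, hndiv⟩ := exists_exactTwoDepth
    (A := (W.baseChange (ringClassField K ι 1)).toAffine.Point) (y := d₁.derivedPoint) (by convert hy)
  have hwn : W.rootNumber = -1 := rootNumber_eq_neg_one_of_analyticRank_eq_one W hr Dt
  have hD0 : ((NumberField.discr K : ℤ) : ℚ) ≠ 0 := by exact_mod_cast NumberField.discr_ne_zero K
  haveI iT : (W.quadraticTwist ((NumberField.discr K : ℤ) : ℚ)).IsElliptic := W.isElliptic_quadraticTwist hD0
  have hs2 : W.HasSurjectiveModNGaloisRep 2 := by simpa using hρ 1 one_pos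
  have hw : ∃ (n : ℕ) (d : KolyvaginHeegnerData Dt β ι n), Squarefree n ∧
      (∀ ℓ ∈ n.primeFactors, Zhang2014.IsKolyvaginPrime (W.conductorNorm ℤ) W K 2 ℓ ∧ 2 ≤ Zhang2014.kolyvaginIndex W 2 ℓ ∧
        ∃ (v : IsDedekindDomain.HeightOneSpectrum (𝓞 ℚ))
          (𝔓 : Ideal (Literature.NumberTheory.GaloisRepresentations.absIntegers (𝓞 ℚ) ℚ)) (h : Field.absoluteGaloisGroup ℚ),
          ((ℓ : ℕ) : 𝓞 ℚ) ∈ v.asIdeal ∧ 𝔓 ∈ v.primesAbove ∧ IsArithFrobAt (𝓞 ℚ) h 𝔓 ∧ ∃ u : W.geomTorsion ((2 : ℕ) : ℤ), h • u ≠ u) ∧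
      ¬ ∃ Q : (W.baseChange (ringClassField K ι n)).toAffine.Point, (2 : ℤ) • Q = d.derivedPoint := by
    rcases Nat.eq_zero_or_pos M₀ with h0 | hpos
    · -- depth 0: the witness is the frame
      have hndiv' : ¬ ∃ Q : (W.baseChange (ringClassField K ι 1)).toAffine.Point, (2 : ℤ) • Q = d₁.derivedPoint := by
        rw [h0] at hndiv
        simpa using hndiv
      exact transpositionWitness_of_depth_zero W K d₁ hndiv'
    · -- depth ≥ 1: `2 ∣ P(1)`, so the door is closed
      obtain ⟨k, rfl⟩ : ∃ k, M₀ = k + 1 := ⟨M₀ - 1, by omega⟩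
      have h2dvd : ∃ Q : (W.baseChange (ringClassField K ι 1)).toAffine.Point, (2 : ℤ) • Q = d₁.derivedPoint := by
        obtain ⟨Q, hQ⟩ := hdiv
        refine ⟨((2 ^ k : ℕ) : ℤ) • Q, ?_⟩
        rw [smul_smul, ← hQ]
        congr 1
        push_cast
        ring
      have hdoor' : Nat.card (Wd.selmerGroup 2) ≠ 1 := hdoor.resolve_left (not_not.mpr h2dvd)
      obtain ⟨v, h2v, hNv, hmult⟩ := hv
      obtain ⟨Cd, hCd⟩ := hWd
      rcases Nat.lt_or_ge k 1 with hk | hk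
      · -- depth exactly 1: B2Q♭⁻± manufactures the witness from the door bit
        obtain rfl : k = 0 := by omega
        obtain ⟨s₀, hs₀, hs0⟩ := exists_selmer_twist_four_ne_zero_of_natCard_selmerGroup_two_ne_one W K hK hs2 Cd hCd hdoor'
        exact exists_transpositionWitness_of_depth_one_of_selmer_twist_ne_zero hQ2 W hcm hT v h2v hNv hmult K hK hodd h3 hH hρ Dt β ι d₁
          (by simpa using hndiv) hwn (1 + 1) le_rfl s₀ hs₀ hs0
      · -- depth ≥ 2: the Kolyvagin leaf
        exact hWit W hcm hr hSel hT hρ ⟨v, h2v, hNv, hmult⟩ K hK hodd h3 hH Dt hc β ι d₁ hy (k + 1) hdiv hndiv (by omega) Wd ⟨Cd, hCd⟩ hbudget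
          hdoor'
  exact ⟨K, iF, iN, hK, hodd, h3, hH, Dt, β, ι, d₁, M₀, hc, hy, hdiv, hndiv, ⟨Wd, iE, iM, hWd, hbudget⟩, hw⟩

/-- **OFF THE CUT: v2.5's road, one curve at a time.**  For a single `W` off the cut: S1′ + DIV′|offcut + NDIV′|offcut + PRINT×6 ⟹ `BSD₂(W)` — the body of
g27's `AnalyticTwin.bsdp_of_wall_of_friedbergHoffstein_of_kex_of_facts` with KEX′ replaced by the two restricted halves at the Friedberg–Hoffstein frame
(the exact `2`-depth of the non-torsion `P(1)` exists; `Nat.dvd_antisymm`).  CONDITIONAL on the displayed hypotheses; proves nothing about BSD. -/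
theorem bsdp_offCut_of_wall_of_halves_of_facts (h1 : RankZeroBSDTwo) (hU : HeegnerIndexUpperOffCutAtTwo) (hL : HeegnerIndexLowerOffCutAtTwo)
    (hGZ : GrossZagierAllLevels) (hGZK : MultPublishedInputsAtTwo) (hmod : EntireLFunctionRat) (hMilneC : MilneAnyModel)
    (hMP : nonempty_modularParametrizationData) (hFH : friedbergHoffstein_exists_heegnerField_split_twist_ne_zero)
    (W : WeierstrassCurve ℚ) [W.IsElliptic] [W.IsGloballyMinimal] (hcm : ¬ W.HasCM) (hr : W.analyticRank = 1)
    (hSel : Nat.card (W.selmerGroup 2) = 2) (hoff : ¬ OnOddHabitatCut W) : BSDp W 2 := by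
  haveI : NeZero (W.conductorNorm ℤ) := ⟨(W.conductorNorm_pos_holds).ne'⟩
  obtain ⟨Dt₀⟩ := hMP W
  have hw : W.rootNumber = -1 := by
    rcases Literature.NumberTheory.EllipticCurves.rootNumber_eq_one_or_eq_neg_one W with h | h
    · exfalso
      have hev : Even W.analyticRank :=
        (Literature.Barriers.BirchSwinnertonDyer.even_analyticRank_iff_of_isNewformOf_conductorLevel Dt₀.isNewformOf).mpr h
      rw [hr] at hev
      exact Nat.not_even_one hev
    · exact h
  -- Friedberg–Hoffstein: a Heegner field with `2` split, `|d_K| > 4`, `L(W^{(d_K)},1) ≠ 0`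
  obtain ⟨K, _, _, hK, hB, hH, h2H, hLv⟩ := hFH W hw 2 Nat.prime_two 4
  have h2 : Module.finrank ℚ K = 2 := hK.1
  have h2K : ((Ideal.span {(2 : ℤ)}).primesOver (𝓞 K)).ncard = 2 := by
    simpa using h2H 2 Nat.prime_two (dvd_refl 2)
  have hodd : Odd (NumberField.discr K) := by
    have h8 := (ncard_primesOver_two_eq_two_iff (K := K) h2).mp h2K
    rw [Int.odd_iff]; omega
  have h3 : NumberField.discr K ≠ -3 := by
    intro h; rw [h] at hB; simp at hB
  have hD0 : (NumberField.discr K : ℚ) ≠ 0 := by exact_mod_cast NumberField.discr_ne_zero K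
  haveI := W.isElliptic_quadraticTwist hD0
  obtain ⟨Cd, hmin⟩ := hasGlobalMinimalModel_rat_holds (W.quadraticTwist (NumberField.discr K : ℚ))
  haveI := hmin
  -- a conductor-1 datum and its Heegner point of infinite order
  obtain ⟨Dt, β, ι, d₁, hc0⟩ := exists_kolyvaginHeegnerData_one_of_nonempty_modularParametrizationData hMP W K hK hH
  have hy : ¬ IsOfFinAddOrder d₁.derivedPoint :=
    not_isOfFinAddOrder_derivedPoint_one_of_rankOne_of_lValue_ne_zero hmod W K (hGZ _ W K) hK hH hr hLv d₁
  -- the exact `2`-depth of `P(1)` exists (Mordell–Weil over `K[1]` + Krull)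
  haveI := (finiteDimensional_and_isGalois_ringClassField hK ι one_ne_zero).1
  haveI : NumberField (ringClassField K ι 1) := NumberField.of_module_finite K _
  haveI : (W.baseChange (ringClassField K ι 1)).IsElliptic := by rw [baseChange]; infer_instance
  haveI : Module.Finite ℤ (W.baseChange (ringClassField K ι 1)).toAffine.Point := by
    convert (W.baseChange (ringClassField K ι 1)).module_finite_point_holds
  obtain ⟨M₀, hdiv, hndiv⟩ := exists_exactTwoDepth
    (A := (W.baseChange (ringClassField K ι 1)).toAffine.Point) (y := d₁.derivedPoint) (by convert hy)
  -- the two restricted halves at this frame give the exactness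
  have hsha : Nat.card (AddCommGroup.primaryComponent (W.baseChange K).sha 2) *
      2 ^ (2 * (padicValInt 2 Dt.c + padicValNat 2 W.tamagawaProduct)) = 2 ^ (2 * M₀) :=
    Nat.dvd_antisymm
      (hU W hcm hr hSel hoff K hK hodd h3 hH h2K (Cd • W.quadraticTwist (NumberField.discr K : ℚ)) ⟨Cd, rfl⟩ hLv Dt β ι d₁ M₀ hdiv hndiv)
      (hL W hcm hr hSel hoff K hK hodd h3 hH h2K (Cd • W.quadraticTwist (NumberField.discr K : ℚ)) ⟨Cd, rfl⟩ hLv Dt β ι d₁ M₀ hdiv hndiv)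
  -- the twin is non-CM of analytic rank 0: `BSD₂(Wd)` from the wall
  have hcmd : ¬ (Cd • W.quadraticTwist (NumberField.discr K : ℚ)).HasCM := by
    rw [hasCM_iff_of_j_eq (((W.quadraticTwist (NumberField.discr K : ℚ)).variableChange_j Cd).trans (W.j_quadraticTwist hD0))]
    exact hcm
  have hrd : (Cd • W.quadraticTwist (NumberField.discr K : ℚ)).analyticRank = 0 := by
    rw [analyticRank_smul]
    exact ((W.quadraticTwist (NumberField.discr K : ℚ)).analyticRank_eq_zero_iff_holds (hmod _)).mpr hLv
  have hBd : BSDp (Cd • W.quadraticTwist (NumberField.discr K : ℚ)) 2 := h1 _ hcmd hrd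
  exact swappedPairDescentAtTwo_shaDepth_anyTwin_of_facts hGZ hGZK hmod hMilneC W hr hSel K hK hodd h3 hH Dt hc0 β ι d₁ hy M₀ hdiv hndiv hsha
    (Cd • W.quadraticTwist (NumberField.discr K : ℚ)) ⟨Cd, rfl⟩ hBd

/-! ## The composition -/

/-- COMPOSITION v2.11 with displayed inputs (no sorry of its own): S1′ + PRINT×8 + Q2 + NVDOOR + WITNESS_{dc,≥2} + DIV′|offcut + NDIV′|offcut prove hTw,
by cases on the odd habitat cut: ON the cut by `TwinAnnihilation.minimalTwinBSDTwo_onOddCut_of_wall_of_transpositionWitnessSupply_of_facts` (p811686)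
fed by `transpositionWitnessSupply_of_frame_of_witness` on the DERIVED FRAME♮ (`oddCutFrameSupplyDoor_of_budgetFrameDoor`), OFF the cut by
`bsdp_offCut_of_wall_of_halves_of_facts`. -/
theorem minimalTwinBSDTwo_of_inputs (h1 : RankZeroBSDTwo) (hQ2 : KolyvaginRelationAtTwo) (hFrame : OddCutBudgetFrameDoorSupplyAtTwo)
    (hWit : OddCutDeepWitnessDoorClosedAtTwo)
    (hU : HeegnerIndexUpperOffCutAtTwo) (hL : HeegnerIndexLowerOffCutAtTwo)
    (hGZ : GrossZagierAllLevels) (hGZK : MultPublishedInputsAtTwo) (hmod : EntireLFunctionRat) (hMilneC : MilneAnyModel)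
    (hMP : nonempty_modularParametrizationData) (hFH : friedbergHoffstein_exists_heegnerField_split_twist_ne_zero)
    (hAU : abbesUllmo_not_dvd_maninConstant_of_not_dvd_level) (hCes : cesnavicius_not_two_dvd_maninConstant_of_two_dvd_level) :
    ∀ (W : WeierstrassCurve ℚ) [W.IsElliptic] [W.IsGloballyMinimal],
      ¬ W.HasCM → W.analyticRank = 1 → Nat.card (W.selmerGroup 2) = 2 → Literature.NumberTheory.EllipticCurves.BSDp W 2 := by
  intro W _ _ hcm hr hSel
  by_cases hcut : OnOddHabitatCut W
  · haveI : NeZero (W.conductorNorm ℤ) := ⟨(W.conductorNorm_pos_holds).ne'⟩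
    obtain ⟨hT, hρ, hv⟩ := hcut
    exact minimalTwinBSDTwo_onOddCut_of_wall_of_transpositionWitnessSupply_of_facts hQ2 hGZ hGZK hmod hMilneC h1
      (transpositionWitnessSupply_of_frame_of_witness hQ2 (oddCutFrameSupplyDoor_of_budgetFrameDoor hAU hCes hMP hGZ hmod hFrame) hWit) W hcm hr
      hSel hT hρ hv
  · exact bsdp_offCut_of_wall_of_halves_of_facts h1 hU hL hGZ hGZK hmod hMilneC hMP hFH W hcm hr hSel hcut

/-- **THE LINE CONCLUDES THE CRUX BY NAME**: `MinimalTwinBSDTwo` (stmt-BirchSwinnertonDyer-22985) from the seven stubs.  Sorry-free outside the stubs. -/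
theorem MinimalTwinBSDTwo_of : Summit.BirchSwinnertonDyer.BirchSwinnertonDyer.Theses.GenusKolyvaginAtTwo.MinimalTwinBSDTwo :=
  minimalTwinBSDTwo_of_inputs
    (rankZeroBSDTwo_of_wall stub_wallRankZeroAtTwo.1 stub_wallRankZeroAtTwo.2.1 stub_wallRankZeroAtTwo.2.2.1 stub_wallRankZeroAtTwo.2.2.2)
    stub_kolyvaginRelationAtTwo stub_oddCutBudgetFrameDoorSupply stub_oddCutDeepWitnessDoorClosed stub_heegnerIndexUpperOffCut
    stub_heegnerIndexLowerOffCut stub_printFacts.1 stub_printFacts.2.1 stub_printFacts.2.2.1 stub_printFacts.2.2.2.1 stub_printFacts.2.2.2.2.1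
    stub_printFacts.2.2.2.2.2.1 stub_printFacts.2.2.2.2.2.2.1 stub_printFacts.2.2.2.2.2.2.2

end Summit.BirchSwinnertonDyer.BirchSwinnertonDyer.Cruxes.MinimalTwinBSDTwo.TwinSwapV211
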